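import Summits.CriticalPhenomena.PercolationContinuityZ3.Theorems.Transplant.GrigorchukTimesZCayleyClasses
import HarnessLib

/-!
# LABEL RIGIDITY of `Cay(𝔊 × ℤ; a, b, c, d, z)`: every graph automorphism preserves each label `a, b, c, d` and maps `z`-edges to `z^{±1}`-edges
# (part II: the alternating walks and the theorem — the B–E census p610435 with `s ↦ z`)

builds on p205010 (kernel theorem, internal audit signed; external expert review pending) — nothing in this file uses p205010; graph theory of ONE Cayley graph,
no percolation statement, nothing about any `@[conjecture]` (MUST-NOTs stand; `θ(p_c)` on this graph is NOT proved in tree or print).  Lane `prim-bschramm`,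
seat `prim-bschramm-p3` gen 39 (DESIGN OWNER; `P3-NILPOTENT.md` §32.3, item O19b; GO lead g26 #8453, refuter-first).  Helper file (`--supports stmt-CriticalPhenomena-4575 --as helper`).
THE CENSUS, continued from «GrigorchukTimesZCayleyClasses»: `Alt8 (u, u·t)` (closed 8-walk `T A T A T A T A`) holds at `d`-edges (`(da)⁴ = 1`) and fails at `b`/`c`
(the 54 certified words of p599763 — read in the `𝔊`-coordinate); `Alt16` holds at `c` (`(ca)⁸ = 1`) and fails at `b` (the 128 words).  MAIN THEOREM
`gzCay_label_rigid (φ : gzCay ≃g gzCay) (u) : φ (u·a) = φ u·a ∧ φ (u·b) = φ u·b ∧ φ (u·c) = φ u·c ∧ φ (u·d) = φ u·d ∧ (φ (u·z) = φ u·z ∨ φ (u·z) = φ u·z⁻¹)`.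
[cite: Grigorchuk1980, relations of 𝔊, (ad)⁴ = 1] [cite: BenjaminiSchramm1996, §2 (Cayley graphs)] [cite: BartholdiErschler2012, §3.1 (wreath recursion — the finite model)]
-/

noncomputable section

namespace Summit.CriticalPhenomena.PercolationContinuityZ3.Theorems.Transplant

namespace Grigorchuk

open SimpleGraph
open scoped Classical

/-! ### §4 The alternating walks on `Cay(𝔊 × ℤ; a, b, c, d, z)` -/

/-- The tree letter `(ℓ, 0)` of `𝔊 × ℤ` named by a p590723 letter. [folklore] -/
def WP (ℓ : Letter) : GZ := (Letter.toG ℓ, 1)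

/-- A tree code names `WP ℓ` for the letter with the same name. [folklore] -/
theorem exists_letter_of_isTree_P {y : L6} (h : y.isTree = true) : ∃ ℓ : Letter, ℓ.isTree = true ∧ L6.toP y = WP ℓ := by
  cases y
  · exact absurd h (by decide)
  · exact ⟨.x .b, rfl, rfl⟩
  · exact ⟨.x .c, rfl, rfl⟩
  · exact ⟨.x .d, rfl, rfl⟩
  · exact absurd h (by decide)
  · exact absurd h (by decide)

/-- A `b/c` code names `WP ℓ` for a letter `ℓ ∈ {b, c}`. [folklore] -/
theorem exists_letter_of_isBC_P {y : L6} (h : y.isBC = true) : ∃ ℓ : Letter, ℓ.isBC = true ∧ L6.toP y = WP ℓ := by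
  cases y
  · exact absurd h (by decide)
  · exact ⟨.x .b, rfl, rfl⟩
  · exact ⟨.x .c, rfl, rfl⟩
  · exact absurd h (by decide)
  · exact absurd h (by decide)
  · exact absurd h (by decide)

/-- `𝔊`-coordinate of `WP ℓ`, and `aP = WP a`, `bP = WP b`. [folklore] -/
theorem coe_fst_WP (ℓ : Letter) : (((WP ℓ).1 : ↥grigorchukGroup) : Equiv.Perm Ray) = ℓ.toPerm := Letter.coe_toG ℓ

/-- **The 54 alternating words in `𝔊 × ℤ`**: `x₁ a x₂ a x₃ a x₄ a ≠ 1` for tree letters with `x₁ ∈ {b, c}` (p599763 `alt8_ne_one`, read in the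
`𝔊`-coordinate). [folklore] -/
theorem alt8P_ne_one (x₁ x₂ x₃ x₄ : Letter) (h₁ : x₁.isBC = true) (h₂ : x₂.isTree = true) (h₃ : x₃.isTree = true) (h₄ : x₄.isTree = true) :
    WP x₁ * aP * WP x₂ * aP * WP x₃ * aP * WP x₄ * aP ≠ 1 := by
  intro e
  apply alt8_ne_one x₁ x₂ x₃ x₄ h₁ h₂ h₃ h₄
  have h := congrArg (fun π : GZ => ((π.1 : ↥grigorchukGroup) : Equiv.Perm Ray)) e
  simp only [Prod.fst_mul, Prod.fst_one, Subgroup.coe_mul, Subgroup.coe_one, coe_fst_WP] at h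
  have ha : (((aP).1 : ↥grigorchukGroup) : Equiv.Perm Ray) = genA := rfl
  rw [ha] at h
  simpa only [evalPerm_cons, evalPerm_nil, Letter.toPerm, mul_one, mul_assoc] using h

/-- **The 128 alternating words in `𝔊 × ℤ`**: `b a x₂ a ⋯ x₈ a ≠ 1` for `xᵢ ∈ {b, c}` (p599763 `alt16_ne_one`). [folklore] -/
theorem alt16P_ne_one (x₂ x₃ x₄ x₅ x₆ x₇ x₈ : Letter) (h₂ : x₂.isBC = true) (h₃ : x₃.isBC = true) (h₄ : x₄.isBC = true)
    (h₅ : x₅.isBC = true) (h₆ : x₆.isBC = true) (h₇ : x₇.isBC = true) (h₈ : x₈.isBC = true) :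
    bP * aP * WP x₂ * aP * WP x₃ * aP * WP x₄ * aP * WP x₅ * aP * WP x₆ * aP * WP x₇ * aP * WP x₈ * aP ≠ 1 := by
  intro e
  apply alt16_ne_one x₂ x₃ x₄ x₅ x₆ x₇ x₈ h₂ h₃ h₄ h₅ h₆ h₇ h₈
  have h := congrArg (fun π : GZ => ((π.1 : ↥grigorchukGroup) : Equiv.Perm Ray)) e
  simp only [Prod.fst_mul, Prod.fst_one, Subgroup.coe_mul, Subgroup.coe_one, coe_fst_WP] at h
  have ha : (((aP).1 : ↥grigorchukGroup) : Equiv.Perm Ray) = genA := rfl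
  have hb : (((bP).1 : ↥grigorchukGroup) : Equiv.Perm Ray) = genB := rfl
  rw [ha, hb] at h
  simpa only [evalPerm_cons, evalPerm_nil, Letter.toPerm, BCD.toPerm, BCD.toV4, V4.toPerm, mul_one, mul_assoc] using h

/-- The alternating word of a list of codes: `t₁ a t₂ a ⋯ t_n a`. [folklore] -/
def altProdP : List L6 → GZ
  | [] => 1
  | t :: ts => L6.toP t * aP * altProdP ts

/-- **Building an alternating return along powers of `t a`.** [folklore] -/
theorem altRet_pow_P {P : GZ → GZ → Prop} {t : L6} (hT : ∀ v : GZ, P v (v * L6.toP t)) :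
    ∀ (n : ℕ) (x : GZ), AltRet gzCay P n x (x * (L6.toP t * aP) ^ n) := by
  intro n
  induction n with
  | zero => intro x; rw [pow_zero, mul_one]; rfl
  | succ n ih =>
    intro x
    refine ⟨x * L6.toP t, x * L6.toP t * aP, hT x, (classesP (x * L6.toP t)).1, ?_⟩
    have e : x * (L6.toP t * aP) ^ (n + 1) = x * L6.toP t * aP * (L6.toP t * aP) ^ n := by rw [pow_succ', ← mul_assoc, ← mul_assoc]
    rw [e]
    exact ih _

/-- **Reading the letters off an alternating return.** [folklore] -/
theorem altRet_letters_P {P : GZ → GZ → Prop} (hP : ∀ u v, P u v → IsT gzCay u v) {Q : L6 → Prop}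
    (hQ : ∀ (v : GZ) (t : L6), P v (v * L6.toP t) → Q t) :
    ∀ (n : ℕ) {w y : GZ}, AltRet gzCay P n w y → ∃ ts : List L6, ts.length = n ∧ (∀ t ∈ ts, Q t) ∧ y = w * altProdP ts := by
  intro n
  induction n with
  | zero =>
    intro w y h
    exact ⟨[], rfl, fun _ h => by simp at h, by rw [altProdP, mul_one]; exact h.symm⟩
  | succ n ih =>
    rintro w y ⟨v, x, h1, h2, h3⟩
    obtain ⟨t, -, rfl⟩ := exists_of_isT_P (hP _ _ h1)
    have hx := eq_of_isA_P h2
    subst hx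
    obtain ⟨ts, hlen, hQts, rfl⟩ := ih h3
    refine ⟨t :: ts, by rw [List.length_cons, hlen], ?_, by rw [altProdP, ← mul_assoc, ← mul_assoc]⟩
    intro t' ht'
    rw [List.mem_cons] at ht'
    rcases ht' with rfl | ht'
    · exact hQ w _ h1
    · exact hQts _ ht'

/-- `(d a)⁴ = 1` and `(c a)⁸ = 1` in `𝔊 × ℤ` (p640733's `dG_aG_pow_four_and` in the first coordinate). [cite: Grigorchuk1980, (ad)⁴ = 1] -/
theorem dP_aP_pow_four_and : (dP * aP) ^ 4 = 1 ∧ (cP * aP) ^ 8 = 1 :=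
  ⟨Prod.ext (by rw [Prod.pow_fst, Prod.fst_one]; exact dG_aG_pow_four_and.1) (by rw [Prod.pow_snd, Prod.snd_one]; exact one_pow _),
    Prod.ext (by rw [Prod.pow_fst, Prod.fst_one]; exact dG_aG_pow_four_and.2) (by rw [Prod.pow_snd, Prod.snd_one]; exact one_pow _)⟩

/-- **`d`-edges lie on an alternating `T/A` closed 8-walk** (`(d a)⁴ = 1`). [folklore] -/
theorem alt8_dP (u : GZ) : Alt8 gzCay u (u * dP) := by
  refine ⟨(classesP u).2.1 .d rfl, u * dP * aP, (classesP _).1, ?_⟩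
  have h := altRet_pow_P (P := IsT gzCay) (t := .d) (fun v => (classesP v).2.1 .d rfl) 3 (u * dP * aP)
  have e : u * dP * aP * (L6.d.toP * aP) ^ 3 = u := by
    show u * dP * aP * (dP * aP) ^ 3 = u
    rw [mul_assoc u, mul_assoc u, ← pow_succ', dP_aP_pow_four_and.1, mul_one]
  rwa [e] at h

/-- **`b`- and `c`-edges lie on NO alternating `T/A` closed 8-walk** (the 54 certified words). [folklore] -/
theorem not_alt8_bcP (u : GZ) {y : L6} (hy : y.isBC = true) : ¬ Alt8 gzCay u (u * L6.toP y) := by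
  rintro ⟨-, w, hA, hret⟩
  have hw := eq_of_isA_P hA
  subst hw
  obtain ⟨ts, hlen, htree, hu⟩ :=
    altRet_letters_P (P := IsT gzCay) (fun _ _ h => h) (Q := fun t => t.isTree = true) (fun v t h => (triE_iff_P v t).1 h.2) 3 hret
  obtain ⟨t₁, t₂, t₃, rfl⟩ := List.length_eq_three.1 hlen
  obtain ⟨ℓ₀, hℓ₀, e₀⟩ := exists_letter_of_isBC_P hy
  obtain ⟨ℓ₁, hℓ₁, e₁⟩ := exists_letter_of_isTree_P (htree t₁ (by simp))
  obtain ⟨ℓ₂, hℓ₂, e₂⟩ := exists_letter_of_isTree_P (htree t₂ (by simp))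
  obtain ⟨ℓ₃, hℓ₃, e₃⟩ := exists_letter_of_isTree_P (htree t₃ (by simp))
  refine alt8P_ne_one ℓ₀ ℓ₁ ℓ₂ ℓ₃ hℓ₀ hℓ₁ hℓ₂ hℓ₃ ?_
  rw [← e₀, ← e₁, ← e₂, ← e₃]
  have h2 : u * (L6.toP y * aP * altProdP [t₁, t₂, t₃]) = u * 1 := by rw [mul_one, ← mul_assoc, ← mul_assoc]; exact hu.symm
  have h3 := mul_left_cancel h2
  simp only [altProdP, mul_one, ← mul_assoc] at h3
  exact h3

/-- **`c`-edges lie on an alternating `(T ∧ ¬Alt8)/A` closed 16-walk** (`(c a)⁸ = 1`). [folklore] -/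
theorem alt16_cP (u : GZ) : Alt16 gzCay u (u * cP) := by
  have hBC : ∀ v : GZ, IsBC gzCay v (v * L6.c.toP) := fun v => ⟨(classesP v).2.1 .c rfl, not_alt8_bcP v (y := .c) rfl⟩
  refine ⟨hBC u, u * cP * aP, (classesP _).1, ?_⟩
  have h := altRet_pow_P (P := IsBC gzCay) (t := .c) hBC 7 (u * cP * aP)
  have e : u * cP * aP * (L6.c.toP * aP) ^ 7 = u := by
    show u * cP * aP * (cP * aP) ^ 7 = u
    rw [mul_assoc u, mul_assoc u, ← pow_succ', dP_aP_pow_four_and.2, mul_one]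
  rwa [e] at h

/-- **`b`-edges lie on NO alternating `(T ∧ ¬Alt8)/A` closed 16-walk** (the 128 certified words). [folklore] -/
theorem not_alt16_bP (u : GZ) : ¬ Alt16 gzCay u (u * bP) := by
  rintro ⟨-, w, hA, hret⟩
  have hw := eq_of_isA_P hA
  subst hw
  have hQ : ∀ (v : GZ) (t : L6), IsBC gzCay v (v * L6.toP t) → t.isBC = true := by
    intro v t ⟨hT, hn8⟩
    have ht := (triE_iff_P v t).1 hT.2
    cases t
    · exact absurd ht (by decide)
    · rfl
    · rfl
    · exact absurd (alt8_dP v) hn8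
    · exact absurd ht (by decide)
    · exact absurd ht (by decide)
  obtain ⟨ts, hlen, hbc, hu⟩ := altRet_letters_P (P := IsBC gzCay) (fun _ _ h => h.1) (Q := fun t => t.isBC = true) hQ 7 hret
  obtain ⟨t₂, ts, rfl⟩ := List.exists_cons_of_length_eq_add_one hlen
  obtain ⟨t₃, ts, rfl⟩ := List.exists_cons_of_length_eq_add_one (Nat.succ.inj hlen)
  obtain ⟨t₄, ts, rfl⟩ := List.exists_cons_of_length_eq_add_one (Nat.succ.inj (Nat.succ.inj hlen))
  obtain ⟨t₅, ts, rfl⟩ := List.exists_cons_of_length_eq_add_one (Nat.succ.inj (Nat.succ.inj (Nat.succ.inj hlen)))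
  obtain ⟨t₆, ts, rfl⟩ := List.exists_cons_of_length_eq_add_one (Nat.succ.inj (Nat.succ.inj (Nat.succ.inj (Nat.succ.inj hlen))))
  obtain ⟨t₇, ts, rfl⟩ := List.exists_cons_of_length_eq_add_one
    (Nat.succ.inj (Nat.succ.inj (Nat.succ.inj (Nat.succ.inj (Nat.succ.inj hlen)))))
  obtain ⟨t₈, ts, rfl⟩ := List.exists_cons_of_length_eq_add_one
    (Nat.succ.inj (Nat.succ.inj (Nat.succ.inj (Nat.succ.inj (Nat.succ.inj (Nat.succ.inj hlen))))))
  obtain rfl : ts = [] := List.eq_nil_of_length_eq_zero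
    (Nat.succ.inj (Nat.succ.inj (Nat.succ.inj (Nat.succ.inj (Nat.succ.inj (Nat.succ.inj (Nat.succ.inj hlen)))))))
  obtain ⟨ℓ₂, hℓ₂, e₂⟩ := exists_letter_of_isBC_P (hbc t₂ (by simp))
  obtain ⟨ℓ₃, hℓ₃, e₃⟩ := exists_letter_of_isBC_P (hbc t₃ (by simp))
  obtain ⟨ℓ₄, hℓ₄, e₄⟩ := exists_letter_of_isBC_P (hbc t₄ (by simp))
  obtain ⟨ℓ₅, hℓ₅, e₅⟩ := exists_letter_of_isBC_P (hbc t₅ (by simp))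
  obtain ⟨ℓ₆, hℓ₆, e₆⟩ := exists_letter_of_isBC_P (hbc t₆ (by simp))
  obtain ⟨ℓ₇, hℓ₇, e₇⟩ := exists_letter_of_isBC_P (hbc t₇ (by simp))
  obtain ⟨ℓ₈, hℓ₈, e₈⟩ := exists_letter_of_isBC_P (hbc t₈ (by simp))
  refine alt16P_ne_one ℓ₂ ℓ₃ ℓ₄ ℓ₅ ℓ₆ ℓ₇ ℓ₈ hℓ₂ hℓ₃ hℓ₄ hℓ₅ hℓ₆ hℓ₇ hℓ₈ ?_
  rw [← e₂, ← e₃, ← e₄, ← e₅, ← e₆, ← e₇, ← e₈]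
  have h2 : u * (bP * aP * altProdP [t₂, t₃, t₄, t₅, t₆, t₇, t₈]) = u * 1 := by
    rw [mul_one, ← mul_assoc, ← mul_assoc]; exact hu.symm
  have h3 := mul_left_cancel h2
  simp only [altProdP, mul_one, ← mul_assoc] at h3
  exact h3

/-! ### §5 Label rigidity -/

/-- **LABEL RIGIDITY OF `Cay(𝔊 × ℤ; a, b, c, d, z)`.**  Every graph automorphism `φ` satisfies `φ (u·a) = φ u · a`, `φ (u·b) = φ u · b`, `φ (u·c) = φ u · c`,
`φ (u·d) = φ u · d` and `φ (u·z) ∈ {φ u · z, φ u · z⁻¹}` at every vertex `u` — `a` = no triangle and no `T`-cornered square, `z^{±}` = no triangle but a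
`T`-cornered square, `{b,c,d}` = in a triangle, `d` = on an alternating 8-walk, `c` = on an alternating 16-walk, `b` = neither.  (The flip `(g, n) ↦ (g, −n)` shows
the `z`-orientation really can be reversed.) [cite: BenjaminiSchramm1996, §2 (Cayley graphs)] [cite: Grigorchuk1980, relations of 𝔊] -/
theorem gzCay_label_rigid (φ : gzCay ≃g gzCay) (u : GZ) :
    φ (u * aP) = φ u * aP ∧ φ (u * bP) = φ u * bP ∧ φ (u * cP) = φ u * cP ∧ φ (u * dP) = φ u * dP ∧
      (φ (u * zP) = φ u * zP ∨ φ (u * zP) = φ u * zP⁻¹) := by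
  obtain ⟨hA, hT, hS, -⟩ := classesP u
  refine ⟨?_, ?_, ?_, ?_, ?_⟩
  · exact eq_of_isA_P ((isA_map_iff φ).2 hA)
  · obtain ⟨y, hy, e⟩ := exists_of_isT_P ((isT_map_iff φ).2 (hT .b rfl))
    have e' : φ (u * bP) = φ u * L6.toP y := e
    have hn8 : ¬ Alt8 gzCay (φ u) (φ u * L6.toP y) := e ▸ (alt8_map_iff φ).not.2 (not_alt8_bcP u (y := .b) rfl)
    have hn16 : ¬ Alt16 gzCay (φ u) (φ u * L6.toP y) := e ▸ (alt16_map_iff φ).not.2 (not_alt16_bP u)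
    rw [e']
    cases y
    · exact absurd hy (by decide)
    · rfl
    · exact absurd (alt16_cP (φ u)) hn16
    · exact absurd (alt8_dP (φ u)) hn8
    · exact absurd hy (by decide)
    · exact absurd hy (by decide)
  · obtain ⟨y, hy, e⟩ := exists_of_isT_P ((isT_map_iff φ).2 (hT .c rfl))
    have e' : φ (u * cP) = φ u * L6.toP y := e
    have hn8 : ¬ Alt8 gzCay (φ u) (φ u * L6.toP y) := e ▸ (alt8_map_iff φ).not.2 (not_alt8_bcP u (y := .c) rfl)
    have h16 : Alt16 gzCay (φ u) (φ u * L6.toP y) := e ▸ (alt16_map_iff φ).2 (alt16_cP u)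
    rw [e']
    cases y
    · exact absurd hy (by decide)
    · exact absurd h16 (not_alt16_bP (φ u))
    · rfl
    · exact absurd (alt8_dP (φ u)) hn8
    · exact absurd hy (by decide)
    · exact absurd hy (by decide)
  · obtain ⟨y, hy, e⟩ := exists_of_isT_P ((isT_map_iff φ).2 (hT .d rfl))
    have e' : φ (u * dP) = φ u * L6.toP y := e
    have h8 : Alt8 gzCay (φ u) (φ u * L6.toP y) := e ▸ (alt8_map_iff φ).2 (alt8_dP u)
    rw [e']
    cases y
    · exact absurd hy (by decide)
    · exact absurd h8 (not_alt8_bcP (φ u) (y := .b) rfl)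
    · exact absurd h8 (not_alt8_bcP (φ u) (y := .c) rfl)
    · rfl
    · exact absurd hy (by decide)
    · exact absurd hy (by decide)
  · exact eq_of_isS_P ((isS_map_iff φ).2 hS)

/-- **Corollary: every automorphism commutes with right multiplication by `a` and by each tree letter.** [folklore] -/
theorem gzCay_aut_mul_tree (φ : gzCay ≃g gzCay) (u : GZ) (y : L6) (hy : y = .a ∨ y.isTree = true) : φ (u * L6.toP y) = φ u * L6.toP y := by
  obtain ⟨ha, hb, hc, hd, -⟩ := gzCay_label_rigid φ u
  rcases hy with rfl | hy
  · exact ha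
  · cases y
    · exact absurd hy (by decide)
    · exact hb
    · exact hc
    · exact hd
    · exact absurd hy (by decide)
    · exact absurd hy (by decide)

end Grigorchuk

end Summit.CriticalPhenomena.PercolationContinuityZ3.Theorems.Transplant
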